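import Literature.Analysis.FluidPDE.OneDirectionSlabGronwall
import Literature.Analysis.FluidPDE.PressureGradientCriterionProofs
import HarnessLib

/-!
# The one-direction derivative criterion `∂₃u ∈ L^p_t L^r_x`, PROVED (Lemarié-Rieusset 2016, Prop. 11.6; Kukavica–Ziane 2007)

Analysis/FluidPDE proof file (theorems only: no definition, no new named fact, no `sorry`).
Search for candidate a priori estimates; no regularity claim (cell `pub-nsfunc`, literature seat:
this file formalises a PUBLISHED proof; nothing new). It DISCHARGES the named fact
`Literature.Analysis.FluidPDE.oneDirectionDerivativeCriterion` (`GradientRegularityCriteria.lean`):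
`theorem oneDirectionDerivativeCriterion_holds : oneDirectionDerivativeCriterion` (net debt `-1`),
following P. G. Lemarié-Rieusset, *The Navier–Stokes Problem in the 21st Century* (2016), §11.5
Prop. 11.6, PDF pp. 357–361 (after I. Kukavica, M. Ziane, J. Math. Phys. 48 (2007) 065203), in
the continuation form of the tree (twin of `pressureGradientCriterion_holds`,
`PressureGradientCriterionProofs.lean`):

* Step A (`exists_lsix_le_of_oneDirection`): on an interval of `H¹`-regularity the functional
  `I = 1 + J³/2 + K/6` (`J = ‖∇u₁‖₂² + ‖∇u₂‖₂²`, `K = ‖u₃‖₆⁶`) is propagated along Tao patches by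
  the slab inequality `oneDirection_functional_le_mul_exp` (`OneDirectionSlabGronwall`;
  LR (11.42)), the patch pressure being the normalised pressure (Stein's bound,
  `ae_patch_pressure_bounds_of_le`); with Sobolev's inequality for `(u₁, u₂, 0)`
  (`lintegral_horizontal_rpow_le`) this bounds `‖u(t)‖₆` uniformly near the right end
  (LR p. 361: "`sup J(t) < +∞` … Thus, `T_MAX = +∞`" — here: no blow-up at `T`).
* Step B: a uniform `L⁶` bound near the right end of an interval of regularity keeps
  `limsup ‖u‖_{H¹}` finite (`limsup_eH1NormSq_lt_top_of_ltheta_bound_near`, `θ = 6`), so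
  `leray_continuation_H1_holds` makes `u` `H¹`-regular on `(0, T]`, and the local strong solution
  from a late good time (Ladyzhenskaya–Prodi–Serrin smoothness, weak–strong uniqueness) extends
  `u` classically past `T` — verbatim the tail of `pressureGradientCriterion_of_three_le`.

## References

* [LemarieRieusset2016] P. G. Lemarié-Rieusset, *The Navier–Stokes Problem in the 21st Century*,
  CRC Press 2016, §11.5 Prop. 11.6 (PDF pp. 357–361).
* [KukavicaZiane2007] I. Kukavica, M. Ziane, *Navier–Stokes equations with regularity in one
  direction*, J. Math. Phys. 48 (2007) 065203.
* [RobinsonRodrigoSadowski2016] J. C. Robinson, J. L. Rodrigo, W. Sadowski, *The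
  three-dimensional Navier–Stokes equations*, CUP 2016 — Lemma 8.16, Thm. 8.17, Thm. 6.15.
* [Tao2011] T. Tao, *Localisation and compactness properties of the Navier–Stokes global
  regularity problem*, Anal. PDE 6 (2013) — §2, Lemma 4.1.
-/

noncomputable section

open MeasureTheory Set Function Filter Topology InnerProductSpace
open Literature.Analysis.FunctionSpaces
open scoped ENNReal NNReal ContDiff RealInnerProductSpace Laplacian

namespace Literature.Analysis.FluidPDE

/-! ### Exponents and the Grönwall weight -/

section Exponents

/-- **Exponent bookkeeping for Prop. 11.6.** In `ℝ≥0∞`: if `2 ≤ q ≤ 3` and `2/q + 3/r = 2`, then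
`0 < r < ∞`, `9/4 ≤ r ≤ 3` (as real numbers), `0 < q < ∞` and `q = 2r/(2r-3)`.
[cite: LemarieRieusset2016, §11.5 Prop. 11.6 (PDF p. 357)] -/
theorem oneDirection_exponents {q r : ℝ≥0∞} (h2q : 2 ≤ q) (hq3 : q ≤ 3) (hqr : 2 / q + 3 / r = 2) :
    r ≠ 0 ∧ r ≠ ⊤ ∧ 9 / 4 ≤ r.toReal ∧ r.toReal ≤ 3 ∧ q ≠ 0 ∧ q ≠ ⊤ ∧
      q.toReal = 2 * r.toReal / (2 * r.toReal - 3) := by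
  have hqtop : q ≠ ⊤ := (lt_of_le_of_lt hq3 (by simp : (3 : ℝ≥0∞) < ⊤)).ne
  have hq0 : q ≠ 0 := (lt_of_lt_of_le (by norm_num) h2q).ne'
  set Q : ℝ := q.toReal with hQ
  have hQ2 : 2 ≤ Q := by
    have h := (ENNReal.toReal_le_toReal (by simp : (2 : ℝ≥0∞) ≠ ⊤) hqtop).2 h2q
    simpa [hQ] using h
  have hQ3 : Q ≤ 3 := by
    have h := (ENNReal.toReal_le_toReal hqtop (by simp : (3 : ℝ≥0∞) ≠ ⊤)).2 hq3
    simpa [hQ] using h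
  have hQ0 : 0 < Q := by linarith
  have h2q' : 2 / q ≠ ⊤ := ENNReal.div_ne_top (by norm_num) hq0
  -- `r ≠ 0`, `r ≠ ⊤`
  have hr0 : r ≠ 0 := by
    rintro rfl
    rw [ENNReal.div_zero (by norm_num : (3 : ℝ≥0∞) ≠ 0), add_top] at hqr
    exact absurd hqr ENNReal.top_ne_ofNat
  have hrtop : r ≠ ⊤ := by
    intro hr
    rw [hr, ENNReal.div_top, add_zero] at hqr
    have h := congrArg ENNReal.toReal hqr
    rw [ENNReal.toReal_div, ENNReal.toReal_ofNat] at h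
    have h' : (2 : ℝ) / Q = 2 := by simpa [hQ] using h
    rw [div_eq_iff hQ0.ne'] at h'
    nlinarith
  have h3r' : 3 / r ≠ ⊤ := ENNReal.div_ne_top (by norm_num) hr0
  set R : ℝ := r.toReal with hR
  have hRpos : 0 < R := ENNReal.toReal_pos hr0 hrtop
  have hreal : 2 / Q + 3 / R = 2 := by
    have h := congrArg ENNReal.toReal hqr
    rw [ENNReal.toReal_add h2q' h3r', ENNReal.toReal_div, ENNReal.toReal_div, ENNReal.toReal_ofNat,
      ENNReal.toReal_ofNat] at h
    simpa [hR, hQ] using h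
  -- `3/R = 2 - 2/Q ∈ [1, 4/3]`
  have h3R : 3 / R = 2 - 2 / Q := by linarith
  have hQinv1 : 2 / Q ≤ 1 := by rw [div_le_one hQ0]; exact hQ2
  have hQinv2 : 2 / 3 ≤ 2 / Q := div_le_div_of_nonneg_left (by norm_num) hQ0 hQ3
  have hR1 : 9 / 4 ≤ R := by
    have h : 3 / R ≤ 4 / 3 := by rw [h3R]; linarith
    rw [div_le_div_iff₀ hRpos (by norm_num)] at h
    linarith
  have hR2 : R ≤ 3 := by
    have h : 1 ≤ 3 / R := by rw [h3R]; linarith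
    rw [le_div_iff₀ hRpos] at h
    linarith
  refine ⟨hr0, hrtop, hR1, hR2, hq0, hqtop, ?_⟩
  have h2R3 : 0 < 2 * R - 3 := by linarith
  have hQ' : 2 / Q = (2 * R - 3) / R := by
    rw [show (2 : ℝ) / Q = 2 - 3 / R by linarith]
    field_simp
  rw [div_eq_div_iff hQ0.ne' hRpos.ne'] at hQ'
  rw [eq_div_iff h2R3.ne']
  linarith

/-- **The Grönwall weight of a member of `L^q_t L^r_x` is finite**: for `0 < q, r < ∞`,
`G ∈ L^q((0,T); L^r)`: `∫₀ᵀ ((∫‖G(t)‖^r)^{1/r})^{q} dt < ∞` (the inner quantity is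
`‖G(t)‖_{L^r}`), and `∫‖G(t)‖^r < ∞` for a.e. `t ∈ (0,T)`.
[cite: LemarieRieusset2016, §11.5 Prop. 11.6 proof, (11.42) (PDF p. 361)] -/
theorem lintegral_ofReal_rpow_oneDirection_lt_top {X F : Type*} [MeasureSpace X]
    [NormedAddCommGroup F] {q r : ℝ≥0∞} {G : ℝ → X → F} {T : ℝ} (hq0 : q ≠ 0) (hqtop : q ≠ ⊤)
    (hr0 : r ≠ 0) (hrtop : r ≠ ⊤) (hS : MemLqLp q r G (Ioo 0 T)) :
    (∫⁻ t in Ioo 0 T, ENNReal.ofReal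
      (((∫⁻ x, ENNReal.ofReal ‖G t x‖ ^ r.toReal) ^ (1 / r.toReal)).toReal ^ q.toReal) < ⊤) ∧
    ∀ᵐ t ∂volume, t ∈ Ioo 0 T → ∫⁻ x, ENNReal.ofReal ‖G t x‖ ^ r.toReal < ⊤ := by
  have hRpos : 0 < r.toReal := ENNReal.toReal_pos hr0 hrtop
  have hQpos : 0 < q.toReal := ENNReal.toReal_pos hq0 hqtop
  -- `((∫‖G t‖^r)^{1/r}) = ‖G t‖_{L^r}`
  have hslice : ∀ t, (∫⁻ x, ENNReal.ofReal ‖G t x‖ ^ r.toReal) ^ (1 / r.toReal) =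
      eLpNorm (G t) r volume := by
    intro t
    rw [eLpNorm_eq_lintegral_rpow_enorm_toReal hr0 hrtop]
    simp_rw [ofReal_norm]
  set N : ℝ → ℝ := fun t => (eLpNorm (G t) r volume).toReal with hN
  have hN0 : ∀ t, 0 ≤ N t := fun t => ENNReal.toReal_nonneg
  refine ⟨?_, ?_⟩
  · have hlt : ∫⁻ t, ‖N t‖ₑ ^ q.toReal ∂(volume.restrict (Ioo 0 T)) < ⊤ :=
      lintegral_rpow_enorm_lt_top_of_eLpNorm_lt_top hq0 hqtop hS.2
    refine lt_of_le_of_lt (le_of_eq (lintegral_congr fun t => ?_)) hlt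
    rw [hslice t, Real.enorm_eq_ofReal (hN0 t), ENNReal.ofReal_rpow_of_nonneg (hN0 t) hQpos.le]
  · have h := hS.1
    rw [ae_restrict_iff' measurableSet_Ioo] at h
    filter_upwards [h] with t ht htI
    have h1 := lintegral_rpow_enorm_lt_top_of_eLpNorm_lt_top hr0 hrtop (ht htI).eLpNorm_lt_top
    refine lt_of_le_of_lt (le_of_eq (lintegral_congr fun x => ?_)) h1
    rw [ofReal_norm]

end Exponents

/-! ### From the functional to `‖u‖₆` on a slice -/

section LSix

/-- Transfer of an a.e.-in-time property along a time translation. [folklore] -/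
private theorem ae_translate_right_od {P : ℝ → Prop} (h : ∀ᵐ σ ∂volume, P σ) (τ₁ : ℝ) :
    ∀ᵐ t ∂volume, P (t + τ₁) := by
  have hmp : MeasurePreserving (fun t : ℝ => t + τ₁) volume volume :=
    measurePreserving_add_right volume τ₁
  have h1 : ∀ᵐ y ∂(Measure.map (fun t : ℝ => t + τ₁) volume), P y := by
    rw [hmp.map_eq]; exact h
  exact ae_of_ae_map hmp.measurable.aemeasurable h1

/-- **`‖v‖₆⁶ ≤ 32(K₁⁶J³ + K)` on a smooth slice** (`v = a + u₃e₃`, `‖a‖₆ ≤ K₁‖∇a‖₂` by Sobolev,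
`K = ‖u₃e₃‖₆⁶`): if `1 + J³/2 + K/6 ≤ R` then `∫|v|⁶ ≤ 64K₁⁶R + 192R` (LR p. 361: a bound on
`J` and `K` controls `‖u‖₆`). [folklore] -/
private theorem lintegral_norm_six_le_od {v : EuclideanSpace ℝ (Fin 3) → EuclideanSpace ℝ (Fin 3)} (hv : ContDiff ℝ ∞ v) {B : ℝ} (hB : ∀ x, ‖v x‖ ≤ B)
    (hv0 : ∫⁻ x, ‖v x‖ₑ ^ 2 < ⊤) (hv1 : ∫⁻ x, ‖iteratedFDeriv ℝ 1 v x‖ₑ ^ 2 < ⊤)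
    (hv2 : ∫⁻ x, ‖iteratedFDeriv ℝ 2 v x‖ₑ ^ 2 < ⊤) (hv3 : ∫⁻ x, ‖iteratedFDeriv ℝ 3 v x‖ₑ ^ 2 < ⊤)
    {Rb : ℝ}
    (hI : 1 + (∫ x, ∑ j, ‖fderiv ℝ (fun y => v y - ⟪(EuclideanSpace.basisFun (Fin 3) ℝ 2), v y⟫ • (EuclideanSpace.basisFun (Fin 3) ℝ 2)) x (EuclideanSpace.basisFun (Fin 3) ℝ j)‖ ^ 2) ^ 3 / 2 +
      (∫ x, ‖⟪(EuclideanSpace.basisFun (Fin 3) ℝ 2), v x⟫ • (EuclideanSpace.basisFun (Fin 3) ℝ 2)‖ ^ (6 : ℝ)) / 6 ≤ Rb) :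
    ∫⁻ x, ENNReal.ofReal (‖v x‖ ^ (6 : ℝ)) ≤
      ENNReal.ofReal (64 * ((SNormLESNormFDerivOfEqConst (EuclideanSpace ℝ (Fin 3))
        (volume : Measure (EuclideanSpace ℝ (Fin 3))) 2 : ℝ)) ^ 6 * Rb + 192 * Rb) := by
  set K₁ : ℝ := (SNormLESNormFDerivOfEqConst (EuclideanSpace ℝ (Fin 3)) (volume : Measure (EuclideanSpace ℝ (Fin 3))) 2 : ℝ) with hK₁
  have hK₁0 : 0 ≤ K₁ := NNReal.coe_nonneg _
  set a : EuclideanSpace ℝ (Fin 3) → EuclideanSpace ℝ (Fin 3) := fun y => v y - ⟪(EuclideanSpace.basisFun (Fin 3) ℝ 2), v y⟫ • (EuclideanSpace.basisFun (Fin 3) ℝ 2) with hadef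
  set w : EuclideanSpace ℝ (Fin 3) → EuclideanSpace ℝ (Fin 3) := fun y => ⟪(EuclideanSpace.basisFun (Fin 3) ℝ 2), v y⟫ • (EuclideanSpace.basisFun (Fin 3) ℝ 2) with hwdef
  set J : ℝ := ∫ x, ∑ j, ‖fderiv ℝ a x (EuclideanSpace.basisFun (Fin 3) ℝ j)‖ ^ 2 with hJ
  set K : ℝ := ∫ x, ‖w x‖ ^ (6 : ℝ) with hK
  have hJ0 : 0 ≤ J := integral_nonneg fun x => Finset.sum_nonneg fun j _ => sq_nonneg _
  have hK0 : 0 ≤ K := integral_nonneg fun x => Real.rpow_nonneg (norm_nonneg _) _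
  have hI' : 1 + J ^ 3 / 2 + K / 6 ≤ Rb := hI
  have hJ3 : J ^ 3 ≤ 2 * Rb := by have := pow_nonneg hJ0 3; linarith
  have hK6 : K ≤ 6 * Rb := by have := pow_nonneg hJ0 3; linarith
  have he1 : ‖((EuclideanSpace.basisFun (Fin 3) ℝ 2) : EuclideanSpace ℝ (Fin 3))‖ = 1 := by simp
  have hB0 : 0 ≤ B := (norm_nonneg _).trans (hB 0)
  have hv1c : ContDiff ℝ 1 v := hv.of_le (by norm_cast)
  have ca : Continuous a := (contDiff_horizontal hv1c (fun x => rfl) : ContDiff ℝ 1 a).continuous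
  have cw : Continuous w := (contDiff_vertical hv1c (fun x => rfl) : ContDiff ℝ 1 w).continuous
  -- Sobolev for the horizontal part: `∫‖a‖⁶ ≤ K₁⁶ J³`
  have hS := lintegral_horizontal_rpow_le (a := a) hv (fun x => rfl) hv0 hv1 hv2 hv3 (m := 6) le_rfl
  have hS' : (∫⁻ x, ‖a x‖ₑ ^ (6 : ℝ)) ^ (1 / 6 : ℝ) ≤ ENNReal.ofReal (K₁ * J ^ (1 / 2 : ℝ)) := by
    have h2 : ENNReal.ofReal (agmonConst * (J * ∫ x, ‖(Δ a) x‖ ^ 2) ^ (1 / 4 : ℝ)) ^ (((6 : ℝ) - 6) / 6) *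
        (((SNormLESNormFDerivOfEqConst (EuclideanSpace ℝ (Fin 3))
          (volume : Measure (EuclideanSpace ℝ (Fin 3))) 2 : ℝ≥0∞)) *
            ENNReal.ofReal J ^ (1 / 2 : ℝ)) ^ ((6 : ℝ) / 6) = ENNReal.ofReal (K₁ * J ^ (1 / 2 : ℝ)) := by
      rw [show ((6 : ℝ) - 6) / 6 = 0 by norm_num, ENNReal.rpow_zero, one_mul,
        show (6 : ℝ) / 6 = 1 by norm_num, ENNReal.rpow_one, hK₁, ENNReal.ofReal_mul (NNReal.coe_nonneg _),
        ENNReal.ofReal_coe_nnreal, ENNReal.ofReal_rpow_of_nonneg hJ0 (by norm_num)]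
    exact hS.trans (le_of_eq h2)
  have ha6 : ∫⁻ x, ‖a x‖ₑ ^ (6 : ℝ) ≤ ENNReal.ofReal (K₁ ^ 6 * J ^ 3) := by
    have h := ENNReal.rpow_le_rpow hS' (by norm_num : (0 : ℝ) ≤ 6)
    rw [← ENNReal.rpow_mul, show (1 / 6 : ℝ) * 6 = 1 by norm_num, ENNReal.rpow_one,
      ENNReal.ofReal_rpow_of_nonneg (mul_nonneg hK₁0 (Real.rpow_nonneg hJ0 _)) (by norm_num)] at h
    refine h.trans (le_of_eq ?_)
    congr 1
    rw [Real.mul_rpow hK₁0 (Real.rpow_nonneg hJ0 _), ← Real.rpow_mul hJ0,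
      show (1 / 2 : ℝ) * 6 = ((3 : ℕ) : ℝ) by norm_num, Real.rpow_natCast,
      show (6 : ℝ) = ((6 : ℕ) : ℝ) by norm_num, Real.rpow_natCast]
  -- the vertical part: `∫‖w‖⁶ = K`
  have hBw : ∀ x, ‖w x‖ ≤ B := fun x => by
    simp only [hwdef, norm_smul, Real.norm_eq_abs, he1, mul_one]
    exact (abs_real_inner_le_norm _ _).trans (by rw [he1, one_mul]; exact hB x)
  have i_v2 : Integrable (fun x => ‖v x‖ ^ 2) volume :=
    FluidPDE.integrable_sq_norm_of_lintegral_lt_top hv.continuous hv0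
  have hpt : ∀ x, ‖w x‖ ^ (6 : ℝ) ≤ B ^ 4 * ‖v x‖ ^ 2 := fun x => by
    have hsplit : ‖w x‖ ^ (6 : ℝ) = ‖w x‖ ^ 4 * ‖w x‖ ^ 2 := by
      rw [show (6 : ℝ) = ((6 : ℕ) : ℝ) by norm_num, Real.rpow_natCast]; ring
    rw [hsplit]
    have hwv : ‖w x‖ ≤ ‖v x‖ := by
      simp only [hwdef, norm_smul, Real.norm_eq_abs, he1, mul_one]
      exact (abs_real_inner_le_norm _ _).trans (by rw [he1, one_mul])
    exact mul_le_mul (pow_le_pow_left₀ (norm_nonneg _) (hBw x) 4)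
      (pow_le_pow_left₀ (norm_nonneg _) hwv 2) (sq_nonneg _) (by positivity)
  have i_w6 : Integrable (fun x => ‖w x‖ ^ (6 : ℝ)) volume :=
    ((i_v2.const_mul (B ^ 4))).mono' (cw.norm.rpow_const fun _ => Or.inr (by norm_num)).aestronglyMeasurable
      (Eventually.of_forall fun x => by
        rw [Real.norm_of_nonneg (Real.rpow_nonneg (norm_nonneg _) _)]; exact hpt x)
  have hw6 : ∫⁻ x, ‖w x‖ₑ ^ (6 : ℝ) = ENNReal.ofReal K := by
    rw [hK, ofReal_integral_eq_lintegral_ofReal i_w6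
      (Eventually.of_forall fun x => Real.rpow_nonneg (norm_nonneg _) _)]
    refine lintegral_congr fun x => ?_
    rw [← ofReal_norm, ENNReal.ofReal_rpow_of_nonneg (norm_nonneg _) (by norm_num)]
  -- pointwise splitting `‖v‖⁶ ≤ 32(‖a‖⁶ + ‖w‖⁶)` and integration
  have hvaw : ∀ x, v x = a x + w x := fun x => by simp only [hadef, hwdef, sub_add_cancel]
  have hpt6 : ∀ x, ENNReal.ofReal (‖v x‖ ^ (6 : ℝ)) ≤ 32 * (‖a x‖ₑ ^ (6 : ℝ) + ‖w x‖ₑ ^ (6 : ℝ)) := by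
    intro x
    have hL : ENNReal.ofReal (‖v x‖ ^ (6 : ℝ)) = ‖v x‖ₑ ^ (6 : ℝ) := by
      rw [← ofReal_norm, ENNReal.ofReal_rpow_of_nonneg (norm_nonneg _) (by norm_num)]
    rw [hL]
    have h1 : ‖v x‖ₑ ≤ ‖a x‖ₑ + ‖w x‖ₑ := by rw [hvaw x]; exact enorm_add_le _ _
    calc ‖v x‖ₑ ^ (6 : ℝ) ≤ (‖a x‖ₑ + ‖w x‖ₑ) ^ (6 : ℝ) := ENNReal.rpow_le_rpow h1 (by norm_num)
      _ ≤ (2 : ℝ≥0∞) ^ ((6 : ℝ) - 1) * (‖a x‖ₑ ^ (6 : ℝ) + ‖w x‖ₑ ^ (6 : ℝ)) :=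
          ENNReal.rpow_add_le_mul_rpow_add_rpow _ _ (by norm_num)
      _ = 32 * (‖a x‖ₑ ^ (6 : ℝ) + ‖w x‖ₑ ^ (6 : ℝ)) := by
          congr 1
          rw [show (6 : ℝ) - 1 = ((5 : ℕ) : ℝ) by norm_num, ENNReal.rpow_natCast]; norm_num
  have ma : Measurable fun x => ‖a x‖ₑ ^ (6 : ℝ) := (ca.measurable.enorm).pow_const _
  calc ∫⁻ x, ENNReal.ofReal (‖v x‖ ^ (6 : ℝ))
      ≤ ∫⁻ x, 32 * (‖a x‖ₑ ^ (6 : ℝ) + ‖w x‖ₑ ^ (6 : ℝ)) := lintegral_mono hpt6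
    _ = 32 * ((∫⁻ x, ‖a x‖ₑ ^ (6 : ℝ)) + ∫⁻ x, ‖w x‖ₑ ^ (6 : ℝ)) := by
        rw [lintegral_const_mul' _ _ (by norm_num), lintegral_add_left ma]
    _ ≤ 32 * (ENNReal.ofReal (K₁ ^ 6 * J ^ 3) + ENNReal.ofReal K) := by rw [hw6]; gcongr
    _ = ENNReal.ofReal (32 * (K₁ ^ 6 * J ^ 3 + K)) := by
        rw [← ENNReal.ofReal_add (mul_nonneg (pow_nonneg hK₁0 6) (pow_nonneg hJ0 3)) hK0,
          ← ENNReal.ofReal_ofNat 32,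
          ← ENNReal.ofReal_mul (by norm_num)]
    _ ≤ ENNReal.ofReal (64 * K₁ ^ 6 * Rb + 192 * Rb) := by
        refine ENNReal.ofReal_le_ofReal ?_
        have hK6' : 0 ≤ K₁ ^ 6 := by positivity
        nlinarith [mul_le_mul_of_nonneg_left hJ3 hK6']

end LSix

/-! ### Step A: the uniform `L⁶` bound near the right end of an interval of regularity -/

section StepA

variable {ν T : ℝ} {u₀ : EuclideanSpace ℝ (Fin 3) → EuclideanSpace ℝ (Fin 3)} {u : ℝ → EuclideanSpace ℝ (Fin 3) → EuclideanSpace ℝ (Fin 3)} {p : ℝ → EuclideanSpace ℝ (Fin 3) → ℝ}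

set_option maxHeartbeats 4000000 in
/-- **Uniform `L⁶` bound towards the right end of an interval of regularity, in the class
`∂₃u ∈ L^{2r/(2r-3)}_t L^r_x`, `9/4 ≤ r ≤ 3`** (Lemarié-Rieusset 2016, proof of Prop. 11.6:
"Thus, we get again that `sup_{t<T₀} J(t) < +∞` … Thus, `T_MAX = +∞`"; here `K = ‖u₃‖₆⁶` and
`‖(u₁,u₂)‖₆ ≲ J^{1/2}` give `sup ‖u(t)‖₆ < ∞`). The functional `I = 1 + J³/2 + K/6` is propagated
along Tao patches (`exists_tao_patch`, real induction `forall_Icc_of_local_propagation`) by the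
slab inequality `oneDirection_functional_le_mul_exp`, the patch pressure being the normalised
pressure (`ae_patch_pressure_bounds_of_le`, Stein's bound at exponent `3r/(r-1)`).
[cite: LemarieRieusset2016, §11.5 Prop. 11.6 proof, (11.42) (PDF p. 361)] -/
theorem exists_lsix_le_of_oneDirection {c : ℝ} (hL2 : TaoH1AlmostRegularWith c) (hc : 0 < c)
    (hν : 0 < ν) (hLH : IsLerayHopfOn T ν 0 u₀ u) (hcl : IsClassicalNSSolutionOn (Ico 0 T) ν 0 u p)
    {R : ℝ} (hR1 : 9 / 4 ≤ R) (hR2 : R ≤ 3)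
    (hLq : ∀ᵐ σ ∂volume, σ ∈ Ioo 0 T →
      ∫⁻ x, ENNReal.ofReal ‖fderiv ℝ (u σ) x (EuclideanSpace.basisFun (Fin 3) ℝ 2)‖ ^ R < ⊤)
    {CS : ℝ≥0}
    (hCS : ∀ v : EuclideanSpace ℝ (Fin 3) → EuclideanSpace ℝ (Fin 3), MemLp v (2 * ENNReal.ofReal (3 * R / (R - 1))) volume →
      eLpNorm (normalisedPressure v) (ENNReal.ofReal (3 * R / (R - 1))) volume ≤
        CS * eLpNorm v (2 * ENNReal.ofReal (3 * R / (R - 1))) volume ^ 2)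
    (hA : ∫⁻ t in Ioo 0 T, ENNReal.ofReal
      (((∫⁻ x, ENNReal.ofReal ‖fderiv ℝ (u t) x (EuclideanSpace.basisFun (Fin 3) ℝ 2)‖ ^ R) ^ (1 / R)).toReal ^ (2 * R / (2 * R - 3))) ≠ ⊤)
    {α β : ℝ} (hα : 0 ≤ α) (hβ : β ≤ T) (hreg : IsH1RegularOn (Ioo α β) u)
    {t₀ : ℝ} (ht₀ : t₀ ∈ Ioo α β) (hy₀ : ∫⁻ x, ENNReal.ofReal (‖u t₀ x‖ ^ (6 : ℝ)) < ⊤) :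
    ∃ K : ℝ≥0∞, K < ⊤ ∧ ∀ t ∈ Ico t₀ β, ∫⁻ x, ENNReal.ofReal (‖u t x‖ ^ (6 : ℝ)) ≤ K := by
  obtain ⟨C, hC0, hslab⟩ := oneDirection_functional_le_mul_exp hν hR1 hR2 CS
  -- Stein's exponent `m = 3R/(R-1)`
  have hm1 : 1 < 3 * R / (R - 1) := by rw [lt_div_iff₀ (by linarith)]; linarith
  obtain ⟨mE, hmE⟩ : ∃ mE : ℝ≥0∞, mE = ENNReal.ofReal (3 * R / (R - 1)) := ⟨_, rfl⟩
  rw [← hmE] at hCS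
  have h1mE : 1 < mE := by
    rw [hmE, ← ENNReal.ofReal_one]; exact (ENNReal.ofReal_lt_ofReal_iff (by linarith)).2 hm1
  have hmEtop : mE < ⊤ := by rw [hmE]; exact ENNReal.ofReal_lt_top
  have h2mE : 2 * mE = ENNReal.ofReal (2 * (3 * R / (R - 1))) := by
    rw [hmE, ENNReal.ofReal_mul (by norm_num : (0:ℝ) ≤ 2), ENNReal.ofReal_ofNat]
  -- the weight and the functional
  obtain ⟨a, ha⟩ : ∃ a : ℝ → ℝ≥0∞, a = fun σ => ENNReal.ofReal
      (((∫⁻ x, ENNReal.ofReal ‖fderiv ℝ (u σ) x (EuclideanSpace.basisFun (Fin 3) ℝ 2)‖ ^ R) ^ (1 / R)).toReal ^ (2 * R / (2 * R - 3))) :=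
    ⟨_, rfl⟩
  have hA' : ∫⁻ t in Ioo 0 T, a t ≠ ⊤ := by rw [ha]; exact hA
  obtain ⟨Ifun, hIfun⟩ : ∃ I : ℝ → ℝ, I = fun τ =>
      1 + (∫ x, ∑ j, ‖fderiv ℝ (fun y => u τ y - ⟪(EuclideanSpace.basisFun (Fin 3) ℝ 2), u τ y⟫ • (EuclideanSpace.basisFun (Fin 3) ℝ 2)) x (EuclideanSpace.basisFun (Fin 3) ℝ j)‖ ^ 2) ^ 3 / 2 +
        (∫ x, ‖⟪(EuclideanSpace.basisFun (Fin 3) ℝ 2), u τ x⟫ • (EuclideanSpace.basisFun (Fin 3) ℝ 2)‖ ^ (6 : ℝ)) / 6 := ⟨_, rfl⟩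
  have hI0 : ∀ τ, 0 ≤ Ifun τ := fun τ => by
    rw [hIfun]; simp only
    have h1 : 0 ≤ ∫ x, ∑ j, ‖fderiv ℝ (fun y => u τ y - ⟪(EuclideanSpace.basisFun (Fin 3) ℝ 2), u τ y⟫ • (EuclideanSpace.basisFun (Fin 3) ℝ 2)) x (EuclideanSpace.basisFun (Fin 3) ℝ j)‖ ^ 2 :=
      integral_nonneg fun x => Finset.sum_nonneg fun j _ => sq_nonneg _
    have h2 : 0 ≤ ∫ x, ‖⟪(EuclideanSpace.basisFun (Fin 3) ℝ 2), u τ x⟫ • (EuclideanSpace.basisFun (Fin 3) ℝ 2)‖ ^ (6 : ℝ) :=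
      integral_nonneg fun x => Real.rpow_nonneg (norm_nonneg _) _
    have h3 := pow_nonneg h1 3
    linarith
  obtain ⟨y, hy⟩ : ∃ y : ℝ → ℝ≥0∞, y = fun τ => ENNReal.ofReal (Ifun τ) := ⟨_, rfl⟩
  have hyt : ∀ τ, y τ = ENNReal.ofReal (Ifun τ) := fun τ => by rw [hy]
  obtain ⟨y₀, hy₀def⟩ : ∃ y₀ : ℝ≥0∞, y₀ = y t₀ := ⟨_, rfl⟩
  -- the constants of the final bound
  set K₁ : ℝ := (SNormLESNormFDerivOfEqConst (EuclideanSpace ℝ (Fin 3)) (volume : Measure (EuclideanSpace ℝ (Fin 3))) 2 : ℝ) with hK₁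
  set Rb : ℝ := Real.exp (C * (∫⁻ σ in Ioo 0 T, a σ).toReal) * Ifun t₀ with hRb
  obtain ⟨Kbig, hKbig⟩ : ∃ Kbig : ℝ≥0∞, Kbig = max (∫⁻ x, ENNReal.ofReal (‖u t₀ x‖ ^ (6 : ℝ)))
    (ENNReal.ofReal (64 * K₁ ^ 6 * Rb + 192 * Rb)) := ⟨_, rfl⟩
  refine ⟨Kbig, by rw [hKbig]; exact max_lt hy₀ ENNReal.ofReal_lt_top, fun t ht => ?_⟩
  have ht₀0 : 0 < t₀ := hα.trans_lt ht₀.1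
  have htT : t < T := ht.2.trans_le hβ
  -- good restarting times
  have hgood : ∀ᵐ s' ∂(volume.restrict (Ioo 0 T)),
      IsLerayHopfOn (T - s') ν 0 (u s') (fun t => u (t + s')) := hLH.ae_isLerayHopfOn_restart hν.le
  -- a uniform `H¹` bound on the compact `[(α + t₀)/2, t]`
  have hKsub : Icc ((α + t₀) / 2) t ⊆ Ioo α β := fun s' hs' =>
    ⟨lt_of_lt_of_le (by linarith [ht₀.1]) hs'.1, hs'.2.trans_lt ht.2⟩
  obtain ⟨M, hM, hbound⟩ := hreg.exists_forall_le isCompact_Icc hKsub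
  set Am : ℝ := M.toReal with hAm
  have hAm0 : 0 ≤ Am := ENNReal.toReal_nonneg
  set τM : ℝ := c * ν ^ 3 / (Am ^ 2 + 1) with hτM
  have hτM0 : 0 < τM := by positivity
  have hτMc : Am ^ 2 * τM ≤ c * ν ^ 3 := by
    rw [hτM, mul_div_assoc']
    rw [div_le_iff₀ (by positivity)]
    nlinarith [mul_pos hc (pow_pos hν 3)]
  -- the propagated property
  obtain ⟨A, hAdef⟩ : ∃ A : ℝ → ℝ, A = fun τ => (∫⁻ σ in Ioo t₀ τ, a σ).toReal := ⟨_, rfl⟩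
  have hAt : ∀ τ, A τ = (∫⁻ σ in Ioo t₀ τ, a σ).toReal := fun τ => by rw [hAdef]
  obtain ⟨P, hPdef⟩ : ∃ P : ℝ → Prop, P = fun τ => y τ ≤ ENNReal.ofReal (Real.exp (C * A τ)) * y₀ ∧
    ∫⁻ x, ENNReal.ofReal (‖u τ x‖ ^ (6 : ℝ)) ≤ Kbig := ⟨_, rfl⟩
  have hPiff : ∀ τ, P τ ↔ (y τ ≤ ENNReal.ofReal (Real.exp (C * A τ)) * y₀ ∧
      ∫⁻ x, ENNReal.ofReal (‖u τ x‖ ^ (6 : ℝ)) ≤ Kbig) := fun τ => by rw [hPdef]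
  have hPt : P t := by
    refine forall_Icc_of_local_propagation (a := t₀) (b := t) (P := P) ?_ ?_ t ⟨ht.1, le_rfl⟩
    · rw [hPiff]
      refine ⟨?_, by rw [hKbig]; exact le_max_left _ _⟩
      rw [hAt, hy₀def]
      simp only [Ioo_self, Measure.restrict_empty, lintegral_zero_measure, ENNReal.toReal_zero,
        mul_zero, Real.exp_zero, ENNReal.ofReal_one, one_mul, le_refl]
    · intro σ hσ
      have hσT : σ ≤ T := (hσ.2.trans ht.2.le).trans hβ
      have hlo : 0 ≤ max ((α + t₀) / 2) (σ - τM / 2) := le_max_of_le_left (by linarith)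
      have hlt : max ((α + t₀) / 2) (σ - τM / 2) < σ :=
        max_lt (by linarith [hσ.1, ht₀.1]) (by linarith)
      obtain ⟨s', hs', hLHs⟩ := exists_mem_Ioo_of_ae_restrict_Ioo hlo hlt hσT hgood
      have hs1 : (α + t₀) / 2 < s' := (le_max_left _ _).trans_lt hs'.1
      have hs2 : σ - τM / 2 < s' := (le_max_right _ _).trans_lt hs'.1
      have hs0 : 0 < s' := lt_of_le_of_lt (by linarith) hs1
      have hsT : s' < T := hs'.2.trans_le hσT
      have hsK : s' ∈ Icc ((α + t₀) / 2) t := ⟨hs1.le, hs'.2.le.trans hσ.2⟩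
      have hAs : eH1NormSq (u s') ≤ ENNReal.ofReal Am := by
        rw [hAm, ENNReal.ofReal_toReal hM.ne]; exact hbound s' hsK
      set τ' : ℝ := min τM (T - s') with hτ'def
      refine ⟨min (σ - s') (τM / 2), lt_min (sub_pos.2 hs'.2) (by positivity), ?_⟩
      intro τ₁ hτ₁ τ₂ hτ₂ hτ₁σ hτ₁₂ hτ₂σ hP1
      rcases eq_or_lt_of_le hτ₁₂ with heq | hlt12
      · rw [← heq]; exact hP1
      rw [hPiff] at hP1 ⊢
      have hδ1 : min (σ - s') (τM / 2) ≤ σ - s' := min_le_left _ _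
      have hδ2 : min (σ - s') (τM / 2) ≤ τM / 2 := min_le_right _ _
      have hsτ₁ : s' < τ₁ := by linarith
      have hτ₁0 : 0 < τ₁ := hs0.trans hsτ₁
      have hτ₂T : τ₂ < T := lt_of_le_of_lt hτ₂.2 htT
      have hτ₂τ' : τ₂ - s' < τ' := by
        refine lt_min (by linarith) ?_
        linarith [hτ₂.2, ht.2, hβ]
      set ε : ℝ := τ₁ - s' with hεdef
      have hε0 : 0 < ε := sub_pos.2 hsτ₁
      have hετ' : ε < τ' := lt_trans (by rw [hεdef]; linarith) hτ₂τ'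
      obtain ⟨w, π, hw, hbw, hbwt, hbπ, hrep⟩ := exists_tao_patch hL2 hν hLH ⟨hs0, hsT⟩ hLHs hAm0
        hAs hτM0 hτMc (ε := ε) ⟨hε0, hετ'⟩
      obtain ⟨hw', hbw', hbwt', hbπ'⟩ := taoSlab_translate hw hbw hbwt hbπ (e := ε) ⟨le_rfl, hετ'⟩
      have hL : 0 < τ' - ε := sub_pos.2 hετ'
      have hrep' : ∀ t' ∈ Icc 0 (τ' - ε), u (t' + τ₁) =ᵐ[volume] w (t' + ε) := by
        intro t' ht'
        have h := hrep (t' + ε) ⟨by linarith [ht'.1], by linarith [ht'.2]⟩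
        have e1 : t' + ε + s' = t' + τ₁ := by rw [hεdef]; ring
        rwa [e1] at h
      have hs12 : τ₂ - τ₁ ∈ Ioc 0 (τ' - ε) := ⟨sub_pos.2 hlt12, by rw [hεdef]; linarith⟩
      have hsub12 : Ioo τ₁ τ₂ ⊆ Ioo 0 T := Ioo_subset_Ioo (by linarith [hτ₁.1]) hτ₂T.le
      have hS' : ∀ t' ∈ Ioo 0 (τ₂ - τ₁), t' + τ₁ ∈ Ico 0 T := fun t' ht' =>
        ⟨by linarith [ht'.1, hτ₁.1, ht₀0], by linarith [ht'.2]⟩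
      -- exact equality of the slices (both are continuous)
      have heqI : ∀ t' ∈ Icc 0 (τ₂ - τ₁), u (t' + τ₁) = w (t' + ε) := by
        intro t' ht'
        have hmem : t' + τ₁ ∈ Ico 0 T := ⟨by linarith [ht'.1], by linarith [ht'.2]⟩
        have hcu : Continuous (u (t' + τ₁)) := (hcl.contDiff_velocity hmem).continuous
        have hcw : Continuous (w (t' + ε)) :=
          (hw'.contDiff_velocity ⟨ht'.1, ht'.2.trans hs12.2⟩).continuous
        exact (Continuous.ae_eq_iff_eq volume hcu hcw).1 (hrep' t' ⟨ht'.1, ht'.2.trans hs12.2⟩)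
      have heqw : ∀ t' ∈ Ioo 0 (τ₂ - τ₁), u (t' + τ₁) = (fun t => w (t + ε)) t' := fun t' ht' =>
        heqI t' ⟨ht'.1.le, ht'.2.le⟩
      -- Stein's bound for the patch pressure (the GNS clause, at the dummy pair `(2, 6)`, is unused)
      have hpb := ae_patch_pressure_bounds_of_le hν hL hw' hbw' (hbπ' 0) hcl hs12.2 hS' heqw
        h1mE hmEtop hCS (q := 2) (r := 6) (by norm_num) (by norm_num) (by norm_num)
        (by rw [ENNReal.toReal_ofNat, ENNReal.toReal_ofNat]; norm_num)
      -- the a.e. finiteness of the `∂₃u` slices, translated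
      have hLq' : ∀ᵐ t' ∂volume, t' ∈ Ioo 0 (τ₂ - τ₁) →
          ∫⁻ x, ENNReal.ofReal ‖fderiv ℝ (u (t' + τ₁)) x (EuclideanSpace.basisFun (Fin 3) ℝ 2)‖ ^ R < ⊤ := by
        filter_upwards [ae_translate_right_od hLq τ₁] with t' ht' ht'I
        exact ht' (hsub12 ⟨by linarith [ht'I.1], by linarith [ht'I.2]⟩)
      have hLqw : ∀ᵐ t' ∂volume, t' ∈ Ioo 0 (τ₂ - τ₁) →
          (∫⁻ x, ENNReal.ofReal ‖fderiv ℝ ((fun t => w (t + ε)) t') x (EuclideanSpace.basisFun (Fin 3) ℝ 2)‖ ^ R < ⊤) ∧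
          eLpNorm ((fun t => π (t + ε)) t') (ENNReal.ofReal (3 * R / (R - 1))) volume ≤
            CS * eLpNorm ((fun t => w (t + ε)) t') (ENNReal.ofReal (2 * (3 * R / (R - 1)))) volume ^ 2 := by
        filter_upwards [hpb, hLq'] with t' ht' hfin ht'I
        obtain ⟨hSt, -⟩ := ht' ht'I
        refine ⟨?_, ?_⟩
        · have h := hfin ht'I
          rw [heqw t' ht'I] at h
          exact h
        · rw [← hmE, ← h2mE]; exact hSt
      -- comparison of the weights
      have hwt : ∀ t' ∈ Ioo 0 (τ₂ - τ₁), ENNReal.ofReal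
          (((∫⁻ x, ENNReal.ofReal ‖fderiv ℝ (w (t' + ε)) x (EuclideanSpace.basisFun (Fin 3) ℝ 2)‖ ^ R) ^ (1 / R)).toReal ^
            (2 * R / (2 * R - 3))) = a (t' + τ₁) := by
        intro t' ht'
        rw [ha]; simp only
        rw [heqw t' ht']
      have hAeq : ∫⁻ t' in Ioo 0 (τ₂ - τ₁), ENNReal.ofReal
          (((∫⁻ x, ENNReal.ofReal ‖fderiv ℝ (w (t' + ε)) x (EuclideanSpace.basisFun (Fin 3) ℝ 2)‖ ^ R) ^ (1 / R)).toReal ^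
            (2 * R / (2 * R - 3))) = ∫⁻ σ' in Ioo τ₁ τ₂, a σ' := by
        calc _ = ∫⁻ t' in Ioo 0 (τ₂ - τ₁), a (t' + τ₁) := by
              exact setLIntegral_congr_fun measurableSet_Ioo fun t' ht' => hwt t' ht'
          _ = ∫⁻ σ' in Ioo τ₁ τ₂, a σ' := by
              rw [setLIntegral_Ioo_comp_add_right a 0 (τ₂ - τ₁) τ₁, zero_add, sub_add_cancel]
      have hfin12 : ∫⁻ σ' in Ioo τ₁ τ₂, a σ' ≠ ⊤ := ne_top_of_le_ne_top hA' (lintegral_mono_set hsub12)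
      have hAfin : ∫⁻ t' in Ioo 0 (τ₂ - τ₁), ENNReal.ofReal
          (((∫⁻ x, ENNReal.ofReal ‖fderiv ℝ (w (t' + ε)) x (EuclideanSpace.basisFun (Fin 3) ℝ 2)‖ ^ R) ^ (1 / R)).toReal ^
            (2 * R / (2 * R - 3))) ≠ ⊤ := by
        rw [hAeq]; exact hfin12
      -- the slab inequality
      have hineq := hslab (τ' - ε) (fun t => w (t + ε)) (fun t => π (t + ε)) (τ₂ - τ₁) hL hw' hbw'
        hbwt' hbπ' hs12 hLqw hAfin
      rw [hAeq] at hineq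
      have hu2 : w (τ₂ - τ₁ + ε) = u τ₂ := by
        have h := (heqI (τ₂ - τ₁) ⟨hs12.1.le, le_rfl⟩).symm
        rwa [sub_add_cancel] at h
      have hu1 : w (0 + ε) = u τ₁ := by
        have h := (heqI 0 ⟨le_rfl, hs12.1.le⟩).symm
        rwa [zero_add τ₁] at h
      have hineq' : Ifun τ₂ ≤ Real.exp (C * (∫⁻ σ' in Ioo τ₁ τ₂, a σ').toReal) * Ifun τ₁ := by
        rw [hIfun]; simp only
        rw [← hu2, ← hu1]
        exact hineq
      have hstep : y τ₂ ≤ ENNReal.ofReal (Real.exp (C * (∫⁻ σ' in Ioo τ₁ τ₂, a σ').toReal)) * y τ₁ := by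
        rw [hyt, hyt, ← ENNReal.ofReal_mul (Real.exp_nonneg _)]
        exact ENNReal.ofReal_le_ofReal hineq'
      have hfin02 : ∫⁻ σ' in Ioo t₀ τ₂, a σ' ≠ ⊤ :=
        ne_top_of_le_ne_top hA' (lintegral_mono_set (Ioo_subset_Ioo ht₀0.le hτ₂T.le))
      have hP1a : y τ₁ ≤ ENNReal.ofReal (Real.exp (C * (∫⁻ σ in Ioo t₀ τ₁, a σ).toReal)) * y₀ := by
        rw [← hAt]; exact hP1.1
      have hP2a : y τ₂ ≤ ENNReal.ofReal (Real.exp (C * (∫⁻ σ in Ioo t₀ τ₂, a σ).toReal)) * y₀ :=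
        exp_lintegral_chain (y := y) (a := a) (C := C) (y₀ := y₀) hτ₁.1 hτ₁₂ hfin02 hP1a hstep
      -- the `L⁶` bound at `τ₂` through the patch slice `u τ₂ = w (τ₂ - τ₁ + ε)`
      have hI2 : Ifun τ₂ ≤ Rb := by
        have h1 : Ifun τ₂ ≤ Real.exp (C * (∫⁻ σ in Ioo t₀ τ₂, a σ).toReal) * Ifun t₀ := by
          have h := hP2a
          rw [hyt, hy₀def, hyt, ← ENNReal.ofReal_mul (Real.exp_nonneg _)] at h
          exact (ENNReal.ofReal_le_ofReal_iff (mul_nonneg (Real.exp_nonneg _) (hI0 t₀))).1 h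
        have h2 : (∫⁻ σ in Ioo t₀ τ₂, a σ).toReal ≤ (∫⁻ σ in Ioo 0 T, a σ).toReal :=
          ENNReal.toReal_mono hA' (lintegral_mono_set (Ioo_subset_Ioo ht₀0.le hτ₂T.le))
        have h3 : Real.exp (C * (∫⁻ σ in Ioo t₀ τ₂, a σ).toReal) ≤
            Real.exp (C * (∫⁻ σ in Ioo 0 T, a σ).toReal) :=
          Real.exp_le_exp.2 (mul_le_mul_of_nonneg_left h2 hC0)
        exact h1.trans (mul_le_mul_of_nonneg_right h3 (hI0 t₀))
      have hL6 : ∫⁻ x, ENNReal.ofReal (‖u τ₂ x‖ ^ (6 : ℝ)) ≤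
          ENNReal.ofReal (64 * K₁ ^ 6 * Rb + 192 * Rb) := by
        have hsI : τ₂ - τ₁ ∈ Icc 0 (τ' - ε) := ⟨hs12.1.le, hs12.2⟩
        obtain ⟨B₀, hB₀⟩ := linfty_bound_of_hasBoundedSobolevNormsOn_holds
          (fun t ht => (hw'.contDiff_velocity ht).of_le (by norm_cast)) hbw'
        obtain ⟨D₀, hD₀⟩ := hbw' 0
        obtain ⟨D₁, hD₁⟩ := hbw' 1
        obtain ⟨D₂, hD₂⟩ := hbw' 2
        obtain ⟨D₃, hD₃⟩ := hbw' 3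
        have h0 : ∫⁻ x, ‖w (τ₂ - τ₁ + ε) x‖ₑ ^ 2 < ⊤ := by
          refine lt_of_le_of_lt ((le_of_eq (lintegral_congr fun x => ?_)).trans (hD₀ _ hsI))
            ENNReal.coe_lt_top
          rw [← ofReal_norm, ← ofReal_norm, norm_iteratedFDeriv_zero]
        have hI2' := hI2
        rw [hIfun] at hI2'; simp only at hI2'
        rw [← hu2] at hI2' ⊢
        exact lintegral_norm_six_le_od (hw'.contDiff_velocity hsI) (hB₀ _ hsI) h0
          ((hD₁ _ hsI).trans_lt ENNReal.coe_lt_top) ((hD₂ _ hsI).trans_lt ENNReal.coe_lt_top)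
          ((hD₃ _ hsI).trans_lt ENNReal.coe_lt_top) hI2'
      refine ⟨by rw [hAt]; exact hP2a, hL6.trans ?_⟩
      rw [hKbig]; exact le_max_right _ _
  exact ((hPiff t).1 hPt).2

end StepA

/-! ### The discharge -/

section Discharge

/-- **The one-direction derivative criterion on `ℝ³`, DISCHARGED** (Kukavica–Ziane 2007;
Lemarié-Rieusset 2016, Prop. 11.6): the named fact
`Literature.Analysis.FluidPDE.oneDirectionDerivativeCriterion` holds — a classical solution of the
unforced Navier–Stokes system on `ℝ³ × [0, T)` which is Leray–Hopf from `u(0)` and has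
`∂₃u ∈ L^q(0, T; L^r)`, `2/q + 3/r = 2`, `2 ≤ q ≤ 3`, extends smoothly past `T`
(Step A `exists_lsix_le_of_oneDirection`, Step B `limsup_eH1NormSq_lt_top_of_ltheta_bound_near`
with `θ = 6`, `leray_continuation_H1_holds`, and the Ladyzhenskaya–Prodi–Serrin tail of
`pressureGradientCriterion_of_three_le`). The decay hypothesis of the fact is not needed.
[cite: LemarieRieusset2016, §11.5 Prop. 11.6 (PDF pp. 357–361)] [cite: KukavicaZiane2007, Thm. 1.1] -/
theorem oneDirectionDerivativeCriterion_holds : oneDirectionDerivativeCriterion := by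
  intro ν T hν hT u p hcl hLH _ q r h2q hq3 hqr hS
  obtain ⟨c, hc, hL2⟩ := tao2011_H1_local_almost_regular_holds
  obtain ⟨hr0, hrtop, hR1, hR2, hq0, hqtop, hqR⟩ := oneDirection_exponents h2q hq3 hqr
  -- Stein's constant at exponent `3r/(r-1)`
  have hm1 : 1 < 3 * r.toReal / (r.toReal - 1) := by rw [lt_div_iff₀ (by linarith)]; linarith
  have h1m : 1 < ENNReal.ofReal (3 * r.toReal / (r.toReal - 1)) := by
    rw [← ENNReal.ofReal_one]; exact (ENNReal.ofReal_lt_ofReal_iff (by linarith)).2 hm1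
  obtain ⟨CS, hCS⟩ := exists_eLpNorm_normalisedPressure_le_sq
    (p := ENNReal.ofReal (3 * r.toReal / (r.toReal - 1))) h1m ENNReal.ofReal_lt_top
  -- the weight
  have hbf : (EuclideanSpace.single (2 : Fin 3) (1 : ℝ)) = (EuclideanSpace.basisFun (Fin 3) ℝ 2) := by simp
  rw [hbf] at hS
  obtain ⟨hA1, hLq⟩ := lintegral_ofReal_rpow_oneDirection_lt_top hq0 hqtop hr0 hrtop hS
  rw [hqR] at hA1
  -- `u` is `H¹`-regular on `(0, T]`
  have hregT : IsH1RegularOn (Ioc 0 T) u := by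
    refine leray_continuation_H1_holds ν T hν hT (u 0) u hLH fun α β hα hαβ hβ hregI => ?_
    obtain ⟨t₀, ht₀m, hy₀⟩ := exists_mem_Ioo_lintegral_norm_rpow_lt_top hL2 hc hν hLH hα hαβ hβ
      hregI (θ := 6) (by norm_num)
    obtain ⟨K, hK, hbd⟩ := exists_lsix_le_of_oneDirection hL2 hc hν hLH hcl hR1 hR2 hLq hCS hA1.ne
      hα hβ hregI ht₀m hy₀
    exact limsup_eH1NormSq_lt_top_of_ltheta_bound_near hν hLH hα hαβ hβ hregI
      (θ := 6) (by norm_num) (δ := β - t₀) (sub_pos.2 ht₀m.2) hK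
      fun t ht => hbd t ⟨by linarith [ht.1], ht.2⟩
  -- `‖u(t)‖²_{H¹} ≤ A < ∞` on `[T/2, T]`
  have hreg : IsH1RegularOn (Icc (T / 2) T) u :=
    hregT.mono fun t ht => ⟨by linarith [ht.1], ht.2⟩
  obtain ⟨A, hAtop, hAle⟩ := hreg.exists_forall_le isCompact_Icc subset_rfl
  obtain ⟨c', hc', hlocc⟩ := leray_local_strong_H1_holds
  have hLPS : ladyzhenskaya_prodi_serrin := ladyzhenskaya_prodi_serrin_holds
  set a : ℝ := A.toReal with ha
  have ha0 : 0 ≤ a := ENNReal.toReal_nonneg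
  set τ : ℝ := c' * ν ^ 3 / (a ^ 2 + 1) with hτ
  have hcν : 0 < c' * ν ^ 3 := mul_pos hc' (pow_pos hν 3)
  have hτpos : 0 < τ := div_pos hcν (by positivity)
  have hτc : a ^ 2 * τ ≤ c' * ν ^ 3 := by
    have h1 : a ^ 2 * τ = c' * ν ^ 3 * (a ^ 2 / (a ^ 2 + 1)) := by
      rw [hτ]
      ring
    rw [h1]
    exact mul_le_of_le_one_right hcν.le (div_le_one_of_le₀ (by linarith) (by positivity))
  set s₀ : ℝ := max (T / 2) (T - τ / 2) with hs₀
  have hs₀0 : 0 ≤ s₀ := le_max_of_le_left (by linarith)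
  have hs₀T : s₀ < T := max_lt (by linarith) (by linarith)
  obtain ⟨s', hs', hLHs⟩ := hLH.exists_isLerayHopfOn_restart_Ioo hν.le hs₀0 hs₀T le_rfl
  have hsT2 : T / 2 ≤ s' := (le_max_left _ _).trans hs'.1.le
  have hsτ : T < s' + τ := by
    have h1 : T - τ / 2 < s' := (le_max_right _ _).trans_lt hs'.1
    linarith
  have hs0 : 0 < s' := by linarith
  have hTs : 0 < T - s' := sub_pos.2 hs'.2
  have hTsτ : T - s' ≤ τ := by linarith
  have hu2 : MemLp (u s') 2 volume := hLH.memLp s' ⟨hs0.le, hs'.2.le⟩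
  have hdiv : IsWeaklyDivFree (u s') := hLHs.isWeaklyDivFree_datum hTs
  have hgrad : eWeakGradL2Sq (u s') ≤ ENNReal.ofReal a := by
    calc eWeakGradL2Sq (u s') ≤ eH1NormSq (u s') := le_add_self
      _ ≤ A := hAle s' ⟨hsT2, hs'.2.le⟩
      _ = ENNReal.ofReal a := (ENNReal.ofReal_toReal hAtop.ne).symm
  obtain ⟨v, hv, hv0, hvreg⟩ := hlocc hν hτpos hu2 hdiv ha0 hgrad hτc
  have hvS : MemLqLp ∞ 6 v (Ioo 0 τ) :=
    memLqLp_top_six_of_isH1RegularOn_Icc hvreg fun t ht => hv.memLp t ht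
  have hr6 : (3 : ℝ≥0∞) < 6 := by norm_num
  have hqr6 : 2 / (∞ : ℝ≥0∞) + 3 / (6 : ℝ≥0∞) ≤ 1 := by
    rw [ENNReal.div_top, zero_add]
    exact ENNReal.div_le_of_le_mul (by norm_num)
  obtain ⟨V, P, hVP, hvV⟩ := hLPS hν hτpos hv hr6 hqr6 hvS
  have hae : ∀ t ∈ Ioc 0 (T - s'), (fun t => u (t + s')) t =ᵐ[volume] v t :=
    serrin_weak_strong_uniqueness_holds hν hTs (hv.of_le hTsτ) hu2 (q := ∞) (r := 6) hr6
      hqr6 (hvS.mono_set (Ioo_subset_Ioo_right hTsτ)) hLHs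
  have heq : ∀ t ∈ Ioo s' T, u t = V (t + -s') := by
    intro t ht
    have hts : t - s' ∈ Ioc 0 (T - s') := ⟨sub_pos.2 ht.1, by linarith [ht.2]⟩
    have h1 : u t =ᵐ[volume] v (t - s') := by
      have h := hae (t - s') hts
      simpa only [sub_add_cancel] using h
    have h2 : v (t - s') =ᵐ[volume] V (t - s') := hvV (t - s') ⟨hts.1, hts.2.trans hTsτ⟩
    have hcu : Continuous (u t) :=
      (hcl.contDiff_velocity ⟨hs0.le.trans ht.1.le, ht.2⟩).continuous
    have hcV : Continuous (V (t - s')) :=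
      (hVP.contDiff_velocity ⟨hts.1, hts.2.trans hTsτ⟩).continuous
    rw [← sub_eq_add_neg]
    exact (Continuous.ae_eq_iff_eq volume hcu hcV).1 (h1.trans h2)
  have h₂ : IsClassicalNSSolutionOn (Ioo s' (s' + τ)) ν 0 (fun t => V (t + -s'))
      (fun t => P (t + -s')) := by
    have hVP' := hVP.comp_add_right (-s')
    have h0 : (fun t => (0 : ℝ → EuclideanSpace ℝ (Fin 3) → EuclideanSpace ℝ (Fin 3)) (t + -s')) = 0 :=
      rfl
    rw [h0] at hVP'
    exact hVP'.mono (fun t ht => ⟨by simp only [mem_Ioo] at ht ⊢; linarith [ht.1],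
      by simp only [mem_Ioo] at ht ⊢; linarith [ht.2]⟩) isOpen_Ioo.uniqueDiffOn
  exact ⟨s' + τ, hsτ, _, _, hcl.glue h₂ hs0.le hs'.2 hsτ.le heq, fun t ht => by
    simp only [if_pos ht.2]⟩

end Discharge

end Literature.Analysis.FluidPDE
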